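import Summits.QuantumAdvantage.QuantumAdvantage.Theorems.LocusDialAffinePointerA

/-!
# LocusDialAffinePointerB — walk sums and the transfer identity `S_k = 2^{N-k}·R_k` (part B of 3)

Cell decomp-qadv, seat lens-2, generation 17 — tree part «AffinePointer» of the node «LocusDial»/«StabilizerDial»
(supports item stmt-QuantumAdvantage-27137 `Theses.StabilizerDial.FewLocusLoss3` ≡ `Theorems.LocusDial.FewLocusLoss3`, whose
first necessary leaf is `AffinePointerLoss3`: tree chain `freePointerLoss3_of_fewLocusLoss3`, `affinePointerLoss3_of_freePointerLoss3`).

THE THEOREM (part C, `affinePointerLoss3 : AffinePointerLoss3`, constant `C = 1`): in the mod-3 ring game on the odd class, a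
strategy whose answer pointer is ANY lookup `π` of ANY `t ≤ (log₂ n)^c` `𝔽₃`-LINEAR FORMS of the input bits (`linHash`) hits a
kernel position (`gCond`) on at most `(1 - 1/n)·2^{n-1}` inputs — in fact on at most `3/4` of the odd class.

THE METHOD (new in the tree: a TRANSFER OPERATOR for the zero-parity walk).  The kernel condition at position `k` reads
`φ_k(x) = k + n + W_k(x) + W(x) ≢ 2 (mod 3)` with `W_k` the occupation count of the prefix zero-parity walk `u_i(x)`.  On a
fibre `{linHash M x = v}` the pointer is constant (`= π v`); the fibre indicator expands by `𝔽₃`-character orthogonality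
(`sum_χ_lin`) into `3^{-t} Σ_λ χ(⟨λ, linHash x - v⟩)`, and each resulting sum `Σ_{x odd} χ(Σ_i μ_i[x_i] + a(W_k + W))` is computed
EXACTLY by a two-state recursion over the walk (`trR`, states = current parity; `trS_eq : S_k = 2^{n-k}·R_k`) whose `ℓ²`-mass
`trQ` contracts by `12/16` every two steps as soon as the occupation phase is nonzero (`trQ_two_step`; here `c_i = a(1 + [i<k])
≠ 0` for all `i < n-1`).  Hence every fibre sum is `≤ 2^n/(16·3^t)` once `n ≥ 16t + 42` (`pow_budget`), the losing inputs
(`φ = 2`) number `≥ (#odd - 2^n/8)/3 ≥ 2^{n-3}` by pointwise orthogonality (`fibre_count`), and the wins are `≤ 2^{n-1} - 2^{n-3}`.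
`t ≤ (log₂ n)^c ≤ √n` eventually is the tree's `TubePlanProof.logPow_le_natSqrt`.

WHAT THIS IS NOT: it is not `FreePointerLoss3` (pointer = arbitrary low-degree polynomials) nor `U = FewLocusLoss3`; the
transfer operator handles phases that are LINEAR in the bits plus the two occupation counts — the degree-`(log n)^c` pointer
of `U` is the next rung (g18).  No `sorry`; standard axioms; no instances, no notation.

PART B (this file): §C the partial phases `phaseK`, the walk sums `trS` / half sums `trH`, locality under flipping a later
bit (`uCoord_update_of_lt`, `zpar_update_of_le`, `phaseK_update_of_le`), the sum-level recursion `trS_succ`, the transfer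
identity `trS_eq`, `trS_top` (top level = the odd-class sum) and the odd-class character sum bound `normSq_oddSum_le`.
-/

set_option linter.dupNamespace false

noncomputable section

open scoped Classical

namespace Summit.QuantumAdvantage.QuantumAdvantage.Theorems.LocusDial

open Finset
open Literature.Computability.QuantumComplexity Literature.Computability.QuantumComplexity.RingHLF
open Summit.QuantumAdvantage.AdviceFreeQNC0
open Summit.QuantumAdvantage.QuantumAdvantage.Theorems.HolonomyDial (gCond)

/-! ## §C  The walk sums `S_k(u) = Σ_{x : zpar_k(x) = u} χ(Φ_k(x))` and the identity `S_k = 2^{N-k}·R_k` -/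

section Walk

variable {N : ℕ}

/-- the partial phase `Φ_k(x) = Σ_{i<k} (μ_i·[x_i] + c_i·[u_i(x)])` (`u_i` = prefix zero-parity, tree `uCoord`). -/
def phaseK (μ c : ℕ → ZMod 3) (k : ℕ) (x : Fin N → Bool) : ZMod 3 :=
  ∑ i : Fin N, if i.val < k then μ i.val * (if x i then 1 else 0) + c i.val * (if uCoord x i then 1 else 0) else 0

/-- the walk sum `S_k(u)` over the inputs whose first `k` bits have zero-parity `u`. -/
def trS (μ c : ℕ → ZMod 3) (N k : ℕ) (u : Bool) : ℂ :=
  ∑ x ∈ (univ : Finset (Fin N → Bool)).filter (fun x => zpar x k = u), χ (phaseK μ c k x)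

/-- the half walk sum: additionally the bit `K` is prescribed. -/
def trH (μ c : ℕ → ZMod 3) (N k : ℕ) (K : Fin N) (b u : Bool) : ℂ :=
  ∑ x ∈ (univ : Finset (Fin N → Bool)).filter (fun x => x K = b ∧ zpar x k = u), χ (phaseK μ c k x)

/-- LocusDialAffinePointerB helper `uCoord_update_of_lt` (decomp-qadv land package; see the module docstring). -/
theorem uCoord_update_of_lt (x : Fin N → Bool) (K i : Fin N) (hi : i.val < K.val) (b : Bool) :
    uCoord (Function.update x K b) i = uCoord x i := by
  have hset : (univ.filter fun j : Fin N => j ≤ i ∧ Function.update x K b j = false) =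
      univ.filter fun j : Fin N => j ≤ i ∧ x j = false := by
    apply filter_congr
    intro j _
    have hj : j ≤ i → j ≠ K := by
      intro h heq; subst heq; exact absurd hi (not_lt.2 (Fin.le_def.1 h))
    constructor
    · rintro ⟨h1, h2⟩; rw [Function.update_of_ne (hj h1)] at h2; exact ⟨h1, h2⟩
    · rintro ⟨h1, h2⟩; exact ⟨h1, by rw [Function.update_of_ne (hj h1)]; exact h2⟩
  unfold uCoord
  rw [hset]

/-- LocusDialAffinePointerB helper `zpar_update_of_le` (decomp-qadv land package; see the module docstring). -/
theorem zpar_update_of_le (x : Fin N → Bool) (K : Fin N) {k : ℕ} (hk : k ≤ K.val) (b : Bool) :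
    zpar (Function.update x K b) k = zpar x k := by
  have hset : (univ.filter fun j : Fin N => j.val < k ∧ Function.update x K b j = false) =
      univ.filter fun j : Fin N => j.val < k ∧ x j = false := by
    apply filter_congr
    intro j _
    have hj : j.val < k → j ≠ K := by intro h heq; subst heq; omega
    constructor
    · rintro ⟨h1, h2⟩; rw [Function.update_of_ne (hj h1)] at h2; exact ⟨h1, h2⟩
    · rintro ⟨h1, h2⟩; exact ⟨h1, by rw [Function.update_of_ne (hj h1)]; exact h2⟩
  unfold zpar
  rw [hset]

/-- LocusDialAffinePointerB helper `phaseK_update_of_le` (decomp-qadv land package; see the module docstring). -/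
theorem phaseK_update_of_le (μ c : ℕ → ZMod 3) {k : ℕ} (x : Fin N → Bool) (K : Fin N) (hk : k ≤ K.val)
    (b : Bool) : phaseK μ c k (Function.update x K b) = phaseK μ c k x := by
  unfold phaseK
  apply sum_congr rfl
  intro i _
  by_cases hi : i.val < k
  · have hiK : i ≠ K := by intro heq; subst heq; omega
    rw [if_pos hi, if_pos hi, Function.update_of_ne hiK, uCoord_update_of_lt x K i (by omega) b]
  · rw [if_neg hi, if_neg hi]

/-- LocusDialAffinePointerB helper `phaseK_zero` (decomp-qadv land package; see the module docstring). -/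
theorem phaseK_zero (μ c : ℕ → ZMod 3) (x : Fin N → Bool) : phaseK μ c 0 x = 0 := by
  unfold phaseK
  exact sum_eq_zero (fun i _ => by simp)

/-- LocusDialAffinePointerB helper `phaseK_succ` (decomp-qadv land package; see the module docstring). -/
theorem phaseK_succ (μ c : ℕ → ZMod 3) {k : ℕ} (hk : k < N) (x : Fin N → Bool) :
    phaseK μ c (k + 1) x = phaseK μ c k x +
      (μ k * (if x ⟨k, hk⟩ then 1 else 0) + c k * (if uCoord x ⟨k, hk⟩ then 1 else 0)) := by
  unfold phaseK
  set K : Fin N := ⟨k, hk⟩ with hK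
  set F : Fin N → ZMod 3 := fun i => μ i.val * (if x i then 1 else 0) + c i.val * (if uCoord x i then 1 else 0)
    with hF
  have hpt : ∀ i : Fin N, (if i.val < k + 1 then F i else 0) = (if i.val < k then F i else 0) +
      (if i = K then F i else 0) := by
    intro i
    by_cases h1 : i.val < k
    · have : i ≠ K := by intro heq; rw [heq, hK] at h1; simp at h1
      rw [if_pos (by omega), if_pos h1, if_neg this, add_zero]
    · by_cases h2 : i = K
      · subst h2
        rw [if_pos (by simp [hK]), if_neg h1, if_pos rfl, zero_add]
      · have : ¬ i.val < k + 1 := by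
          intro h; apply h2; apply Fin.ext; rw [hK]; simp; omega
        rw [if_neg this, if_neg h1, if_neg h2, add_zero]
  show (∑ i : Fin N, if i.val < k + 1 then F i else 0) = (∑ i : Fin N, if i.val < k then F i else 0) + F K
  simp_rw [hpt]
  rw [sum_add_distrib, Finset.sum_ite_eq' univ K, if_pos (mem_univ K)]

/-- the two halves are equal (flip the prescribed bit: the phase and the parity read only earlier bits). -/
theorem trH_true_eq_false (μ c : ℕ → ZMod 3) {k : ℕ} (K : Fin N) (hk : k ≤ K.val) (u : Bool) :
    trH μ c N k K true u = trH μ c N k K false u := by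
  unfold trH
  refine sum_nbij' (fun x => Function.update x K false) (fun x => Function.update x K true) ?_ ?_ ?_ ?_ ?_
  · intro x hx
    simp only [mem_filter, mem_univ, true_and] at hx ⊢
    exact ⟨by simp, by rw [zpar_update_of_le x K hk]; exact hx.2⟩
  · intro x hx
    simp only [mem_filter, mem_univ, true_and] at hx ⊢
    exact ⟨by simp, by rw [zpar_update_of_le x K hk]; exact hx.2⟩
  · intro x hx
    simp only [mem_filter, mem_univ, true_and] at hx
    rw [Function.update_idem, ← hx.1, Function.update_eq_self]
  · intro x hx
    simp only [mem_filter, mem_univ, true_and] at hx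
    rw [Function.update_idem, ← hx.1, Function.update_eq_self]
  · intro x _
    rw [phaseK_update_of_le μ c x K hk]

/-- the two halves add up to the walk sum. -/
theorem trH_add (μ c : ℕ → ZMod 3) (k : ℕ) (K : Fin N) (u : Bool) :
    trH μ c N k K true u + trH μ c N k K false u = trS μ c N k u := by
  unfold trH trS
  rw [sum_filter, sum_filter, sum_filter, ← sum_add_distrib]
  apply sum_congr rfl
  intro x _
  cases hx : x K <;> simp

/-- LocusDialAffinePointerB helper `two_mul_trH` (decomp-qadv land package; see the module docstring). -/
theorem two_mul_trH (μ c : ℕ → ZMod 3) {k : ℕ} (K : Fin N) (hk : k ≤ K.val) (b u : Bool) :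
    2 * trH μ c N k K b u = trS μ c N k u := by
  rw [two_mul, ← trH_add μ c k K u]
  cases b
  · rw [trH_true_eq_false μ c K hk]
  · rw [trH_true_eq_false μ c K hk]

/-- the walk recursion at the level of sums. -/
theorem trS_succ (μ c : ℕ → ZMod 3) {k : ℕ} (hk : k < N) (u' : Bool) :
    trS μ c N (k + 1) u' = χ (if u' then c k else 0) *
      (χ (μ k) * trH μ c N k ⟨k, hk⟩ true u' + trH μ c N k ⟨k, hk⟩ false (!u')) := by
  have hpt : ∀ x : Fin N → Bool,
      (if zpar x (k + 1) = u' then χ (phaseK μ c (k + 1) x) else 0) =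
        χ (if u' then c k else 0) * (χ (μ k) * (if (x ⟨k, hk⟩ = true ∧ zpar x k = u') then χ (phaseK μ c k x) else 0)
          + (if (x ⟨k, hk⟩ = false ∧ zpar x k = !u') then χ (phaseK μ c k x) else 0)) := by
    intro x
    have hu : uCoord x ⟨k, hk⟩ = zpar x (k + 1) := by rw [uCoord_eq_zpar]
    have hz : zpar x (k + 1) = xor (zpar x k) (!x ⟨k, hk⟩) := zpar_succ x hk
    have hph := phaseK_succ μ c hk x
    rw [hu] at hph
    rw [hph, hz]
    rw [hz] at hph
    cases hxK : x ⟨k, hk⟩ <;> cases hzk : zpar x k <;> cases u' <;>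
      simp [χ_add, χ_zero] <;> ring
  unfold trS trH
  rw [sum_filter, sum_filter, sum_filter]
  simp_rw [hpt]
  rw [mul_sum, ← sum_add_distrib, mul_sum]

/-- **the transfer identity** `S_k(u) = 2^{N-k}·R_k(u)`. -/
theorem trS_eq (μ c : ℕ → ZMod 3) : ∀ k, k ≤ N → ∀ u : Bool, trS μ c N k u = 2 ^ (N - k) * trR μ c k u := by
  intro k
  induction k with
  | zero =>
    intro _ u
    unfold trS
    have hf : ∀ x : Fin N → Bool, zpar x 0 = false := fun x => zpar_zero x
    cases u
    · have hset : (univ.filter fun x : Fin N → Bool => zpar x 0 = false) = univ :=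
        filter_true_of_mem (fun x _ => hf x)
      rw [hset]
      simp only [phaseK_zero, χ_zero, sum_const, card_univ, Fintype.card_fun, Fintype.card_bool,
        Fintype.card_fin, nsmul_eq_mul, mul_one, Nat.sub_zero, trR, Bool.false_eq_true, if_false]
      push_cast
      ring
    · have hset : (univ.filter fun x : Fin N → Bool => zpar x 0 = true) = ∅ :=
        filter_false_of_mem (fun x _ => by rw [hf x]; exact Bool.false_ne_true)
      rw [hset, sum_empty]
      simp [trR]
  | succ k ih =>
    intro hk u'
    have hkN : k < N := by omega
    have ih' := ih (by omega)
    have hH : ∀ b u, trH μ c N k ⟨k, hkN⟩ b u = 2 ^ (N - k - 1) * trR μ c k u := by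
      intro b u
      have h2 := two_mul_trH μ c (N := N) ⟨k, hkN⟩ (le_refl k) b u
      rw [ih' u, show N - k = (N - k - 1) + 1 by omega, pow_succ] at h2
      have : (2 : ℂ) * trH μ c N k ⟨k, hkN⟩ b u = 2 * (2 ^ (N - k - 1) * trR μ c k u) := by
        rw [h2]; ring
      exact mul_left_cancel₀ (by norm_num) this
    rw [trS_succ μ c hkN u', hH, hH, show N - (k + 1) = N - k - 1 by omega]
    simp only [trR]
    ring

/-- at the top (`k = N`) the walk sum is the ODD-CLASS character sum of the full phase. -/
theorem trS_top (μ c : ℕ → ZMod 3) :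
    trS μ c N N true = ∑ x ∈ (univ : Finset (Fin N → Bool)).filter (fun x => OddZeros x), χ (phaseK μ c N x) := by
  unfold trS
  apply sum_congr _ (fun _ _ => rfl)
  apply filter_congr
  intro x _
  unfold zpar OddZeros
  rw [decide_eq_true_iff]
  have : (univ.filter fun j : Fin N => j.val < N ∧ x j = false) = univ.filter fun j : Fin N => x j = false :=
    filter_congr (fun j _ => by simp [j.isLt])
  rw [this]

/-- **the odd-class character sum bound**: for bit phases `μ`, occupation phases `c` with `c_i ≠ 0` (`i + 1 < N`),
`|Σ_{x odd} χ(Φ_N(x))|² ≤ 4^{N-2j}·12^j`, `j = ⌊(N-1)/2⌋`. -/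
theorem normSq_oddSum_le (μ c : ℕ → ZMod 3) (hc : ∀ i, i + 1 < N → c i ≠ 0) :
    Complex.normSq (∑ x ∈ (univ : Finset (Fin N → Bool)).filter (fun x => OddZeros x), χ (phaseK μ c N x)) ≤
      4 ^ (N - 2 * ((N - 1) / 2)) * 12 ^ ((N - 1) / 2) := by
  rw [← trS_top, trS_eq μ c N (le_refl N) true, Nat.sub_self, pow_zero, one_mul]
  exact normSq_trR_le μ c N hc

end Walk


end Summit.QuantumAdvantage.QuantumAdvantage.Theorems.LocusDial
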